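import Literature.Analysis.Complex.ArgumentPrincipleRectangle
import HarnessLib

/-!
# The argument principle with a weight (residue theorem for `(f'/f)·g` on a rectangle)

Trunk T-ANALYSIS support (`Literature/Analysis/Complex`). The tree has the argument principle on a
rectangle, `∮_{∂R} f'/f = 2πi Σ m(ρ)` (`Literature.Analysis.Complex.rectBoundaryIntegral_logDeriv_eq_sum`,
`ArgumentPrincipleRectangle.lean`) and Cauchy's integral formula for a rectangle
(`Literature.Analysis.Complex.integral_boundary_rect_div_sub_eq`, `RectangleCauchyFormula.lean`). This file combines
the two into the weighted form used to derive explicit formulae (the residue theorem for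
`(f'/f)(z) g(z)`, whose poles in `R` are the zeros `ρ` of `f`, with residues `m(ρ) g(ρ)`):

* `Literature.Analysis.Complex.rectBoundaryIntegral_logDeriv_mul_eq_sum` — for `f` analytic on the closed rectangle
  `K = [a,b] × [c,d]`, `g` analytic on `K`, and `S ⊆ K°` finite containing the zeros of `f` in `K`,
  `∮_{∂K} (f'/f)·g = 2πi Σ_{ρ ∈ S} m(ρ) g(ρ)` (`m(ρ) = meromorphicOrderAt f ρ`), in the four-term
  boundary convention of Mathlib (bottom − top + i·right − i·left, `Literature.Analysis.Complex.rectBoundaryIntegral`);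
* `Literature.Analysis.Complex.integral_boundary_rect_logDeriv_mul` — the same with the sum over the (finite) zero
  set of `f` in `K°`, for `f` non-zero on `∂K`.

Proof: the induction of `ArgumentPrincipleRectangle.lean` on the finite set of zeros (divide out
`(z-ρ)^{m}`, so `(f'/f)g = m·g/(z-ρ) + (f₁'/f₁)g` on `∂K`), with Cauchy's integral formula
`∮ g(z)/(z-ρ) dz = 2πi g(ρ)` in place of the winding number. Textbook statement: Conway,
*Functions of One Complex Variable I*, V.3.4–3.6 (argument principle with a weight `g`:
`(1/2πi)∮_γ g f'/f = Σ n(γ; z_k) g(z_k) − Σ n(γ; p_j) g(p_j)`), for the rectangle contour.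

## References

* J. B. Conway, *Functions of One Complex Variable I*, 2nd ed., GTM 11, Springer 1978, Ch. V,
  Thm. 3.6.
-/

noncomputable section

open Complex Set MeasureTheory Filter Topology intervalIntegral

namespace Literature.Analysis.Complex

variable {a b c d : ℝ}

/-- Elementary identity used to log-differentiate `(z-ρ)^m · f₁`: `m w^{m-1} = w^m · (m w⁻¹)`
for `w ≠ 0`. [folklore] -/
private lemma natCast_mul_pow_pred' (w : ℂ) (hw : w ≠ 0) (m : ℕ) :
    (m : ℂ) * w ^ (m - 1) = w ^ m * (m * w⁻¹) := by
  cases m with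
  | zero => simp
  | succ k =>
    rw [Nat.add_sub_cancel, pow_succ]
    field_simp

/-- **Cauchy's integral formula, `rectBoundaryIntegral` form**: `∮_{∂K} m·g(z)/(z-ρ) dz = 2πi·m·g(ρ)`
for `g` analytic on the closed rectangle and `ρ` interior. [folklore] -/
lemma rectBoundaryIntegral_const_mul_div_sub {g : ℂ → ℂ} (m ρ : ℂ) (ha : a < ρ.re) (hb : ρ.re < b)
    (hc : c < ρ.im) (hd : ρ.im < d) (hg : DifferentiableOn ℂ g (Icc a b ×ℂ Icc c d)) :
    rectBoundaryIntegral (fun z ↦ m * (g z / (z - ρ))) a b c d = 2 * Real.pi * I * m * g ρ := by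
  rw [rectBoundaryIntegral_const_mul, rectBoundaryIntegral]
  have := integral_boundary_rect_div_sub_eq (f := g) ρ ha hb hc hd hg
  rw [this]
  ring

/-- **The weighted argument principle on a rectangle**, inductive form. Let `f` and `g` be
analytic at every point of the closed rectangle `K = [a,b] × [c,d]` (`a < b`, `c < d`) and let `S`
be a finite subset of the open rectangle containing all zeros of `f` in `K`. Then
`∮_{∂K} (f'/f)·g = 2πi · Σ_{ρ ∈ S} m(ρ) g(ρ)`, `m(ρ) = meromorphicOrderAt f ρ` (`0` at the points
of `S` where `f ≠ 0`): the residue theorem for `(f'/f)g`, whose residue at a zero `ρ` of `f` of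
multiplicity `m` is `m·g(ρ)`. [cite: Conway1978, Ch. V Thm. 3.6] -/
theorem rectBoundaryIntegral_logDeriv_mul_eq_sum (hab : a < b) (hcd : c < d) {g : ℂ → ℂ}
    (hg : AnalyticOnNhd ℂ g (Icc a b ×ℂ Icc c d)) (S : Finset ℂ) :
    ∀ f : ℂ → ℂ, AnalyticOnNhd ℂ f (Icc a b ×ℂ Icc c d) →
      (∀ z ∈ Icc a b ×ℂ Icc c d, f z = 0 → z ∈ S) → ((S : Set ℂ) ⊆ Ioo a b ×ℂ Ioo c d) →
      rectBoundaryIntegral (fun z ↦ deriv f z / f z * g z) a b c d =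
        2 * Real.pi * I * ∑ ρ ∈ S, ((meromorphicOrderAt f ρ).untop₀ : ℂ) * g ρ := by
  classical
  have hgd : DifferentiableOn ℂ g (Icc a b ×ℂ Icc c d) := hg.differentiableOn
  induction S using Finset.induction_on with
  | empty =>
    intro f hf hzero _
    have hne : ∀ z ∈ Icc a b ×ℂ Icc c d, f z ≠ 0 := fun z hz h0 ↦ by simpa using hzero z hz h0
    have hd : DifferentiableOn ℂ (fun z ↦ deriv f z / f z * g z) (Icc a b ×ℂ Icc c d) := by
      intro z hz
      exact ((((hf z hz).deriv.differentiableAt).div (hf z hz).differentiableAt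
        (hne z hz)).mul (hg z hz).differentiableAt).differentiableWithinAt
    rw [rectBoundaryIntegral_eq_zero_of_differentiableOn hab.le hcd.le hd]
    simp
  | insert ρ S' hρS' ih =>
    intro f hf hzero hsub
    -- location of ρ
    have hρS : ρ ∈ Ioo a b ×ℂ Ioo c d := hsub (Finset.mem_coe.2 (Finset.mem_insert_self ρ S'))
    have hρK : ρ ∈ Icc a b ×ℂ Icc c d := ⟨Ioo_subset_Icc_self hρS.1, Ioo_subset_Icc_self hρS.2⟩
    -- f is non-zero off the open rectangle, in particular at the corner a + ci
    have hbd : ∀ z ∈ Icc a b ×ℂ Icc c d, z ∉ Ioo a b ×ℂ Ioo c d → f z ≠ 0 :=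
      fun z hz hnot h0 ↦ hnot (hsub (Finset.mem_coe.2 (hzero z hz h0)))
    have hcorner : ((a : ℂ) + c * I) ∈ Icc a b ×ℂ Icc c d :=
      ⟨by simpa using hab.le, by simpa using hcd.le⟩
    have hcorner' : ((a : ℂ) + c * I) ∉ Ioo a b ×ℂ Ioo c d := by
      intro h
      have := h.1.1
      simp at this
    have hw : f (a + c * I) ≠ 0 := hbd _ hcorner hcorner'
    -- local factorisation at ρ
    have hne_top : analyticOrderAt f ρ ≠ ⊤ :=
      analyticOrderAt_ne_top_of_reProdIm hab.le hcd.le hf hcorner hw hρK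
    obtain ⟨g₀, hg₀_an, hg₀_ne, hfg₀⟩ := (hf ρ hρK).analyticOrderAt_ne_top.mp hne_top
    set m : ℕ := analyticOrderNatAt f ρ with hm
    -- the quotient f₁ = f/(z-ρ)^m, extended by g₀ ρ at ρ
    set f₁ : ℂ → ℂ := fun z ↦ if z = ρ then g₀ ρ else f z / (z - ρ) ^ m with hf₁_def
    have hf₁_of_ne : ∀ z, z ≠ ρ → f₁ z = f z / (z - ρ) ^ m := fun z hz ↦ by
      simp [hf₁_def, hz]
    have hf_eq : ∀ z, z ≠ ρ → f z = (z - ρ) ^ m * f₁ z := fun z hz ↦ by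
      rw [hf₁_of_ne z hz, mul_div_cancel₀ _ (pow_ne_zero _ (sub_ne_zero.2 hz))]
    have hf₁ρ : f₁ =ᶠ[𝓝 ρ] g₀ := by
      filter_upwards [hfg₀] with z hz
      by_cases hzρ : z = ρ
      · subst hzρ; simp [hf₁_def]
      · rw [hf₁_of_ne z hzρ, hz, smul_eq_mul, mul_div_cancel_left₀ _
          (pow_ne_zero _ (sub_ne_zero.2 hzρ))]
    -- f agrees with (z-ρ)^m f₁ near every point other than ρ
    have hf_ev : ∀ z, z ≠ ρ → f =ᶠ[𝓝 z] fun w ↦ (w - ρ) ^ m * f₁ w := fun z hz ↦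
      (isOpen_ne.eventually_mem hz).mono fun w hw ↦ hf_eq w hw
    -- analyticity of f₁ on K
    have hf₁_an : AnalyticOnNhd ℂ f₁ (Icc a b ×ℂ Icc c d) := by
      intro z hz
      by_cases hzρ : z = ρ
      · subst hzρ
        exact hg₀_an.congr hf₁ρ.symm
      · have h1 : AnalyticAt ℂ (fun w ↦ f w / (w - ρ) ^ m) z :=
          (hf z hz).div ((analyticAt_id.sub analyticAt_const).pow m)
            (pow_ne_zero _ (sub_ne_zero.2 hzρ))
        refine h1.congr ?_
        exact (isOpen_ne.eventually_mem hzρ).mono fun w hw ↦ (hf₁_of_ne w hw).symm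
    -- zeros of f₁ in K lie in S'
    have hzero' : ∀ z ∈ Icc a b ×ℂ Icc c d, f₁ z = 0 → z ∈ S' := by
      intro z hz h0
      by_cases hzρ : z = ρ
      · subst hzρ
        exact absurd (by simpa [hf₁_def] using h0) hg₀_ne
      · have hfz : f z = 0 := by rw [hf_eq z hzρ, h0, mul_zero]
        have := hzero z hz hfz
        rw [Finset.mem_insert] at this
        exact this.resolve_left hzρ
    have hsub' : ((S' : Set ℂ)) ⊆ Ioo a b ×ℂ Ioo c d :=
      (Finset.coe_subset.2 (Finset.subset_insert ρ S')).trans hsub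
    have hIH := ih f₁ hf₁_an hzero' hsub'
    -- the weighted logarithmic derivative splits:
    -- (f'/f) g = m·g/(z-ρ) + (f₁'/f₁) g where f ≠ 0, z ≠ ρ, z ∈ K
    have hsplit : ∀ z ∈ Icc a b ×ℂ Icc c d, z ≠ ρ → f z ≠ 0 →
        deriv f z / f z * g z = (m : ℂ) * (g z / (z - ρ)) + deriv f₁ z / f₁ z * g z := by
      intro z hz hzρ hfz
      have hzρ' : z - ρ ≠ 0 := sub_ne_zero.2 hzρ
      have hf₁z : f₁ z ≠ 0 := by
        intro h0; exact hfz (by rw [hf_eq z hzρ, h0, mul_zero])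
      have hderiv : deriv f z = (m : ℂ) * (z - ρ) ^ (m - 1) * f₁ z + (z - ρ) ^ m * deriv f₁ z := by
        rw [(hf_ev z hzρ).deriv_eq]
        have h1 : HasDerivAt (fun w : ℂ ↦ (w - ρ) ^ m) ((m : ℂ) * (z - ρ) ^ (m - 1) * 1) z :=
          ((hasDerivAt_id z).sub_const ρ).pow m
        have h2 : HasDerivAt f₁ (deriv f₁ z) z := (hf₁_an z hz).differentiableAt.hasDerivAt
        have h3 : HasDerivAt (fun w : ℂ ↦ (w - ρ) ^ m * f₁ w)
            ((m : ℂ) * (z - ρ) ^ (m - 1) * 1 * f₁ z + (z - ρ) ^ m * deriv f₁ z) z := h1.mul h2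
        rw [h3.deriv]
        ring
      rw [hderiv, natCast_mul_pow_pred' (z - ρ) hzρ' m, hf_eq z hzρ]
      field_simp
    -- boundary points are in K, differ from ρ, and f ≠ 0 there
    have hbot_mem : ∀ x ∈ Icc a b, ((x : ℂ) + c * I) ∈ Icc a b ×ℂ Icc c d := fun x hx ↦
      ⟨by simpa using hx, by simpa using hcd.le⟩
    have htop_mem : ∀ x ∈ Icc a b, ((x : ℂ) + d * I) ∈ Icc a b ×ℂ Icc c d := fun x hx ↦
      ⟨by simpa using hx, by simpa using hcd.le⟩
    have hleft_mem : ∀ y ∈ Icc c d, ((a : ℂ) + y * I) ∈ Icc a b ×ℂ Icc c d := fun y hy ↦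
      ⟨by simpa using hab.le, by simpa using hy⟩
    have hright_mem : ∀ y ∈ Icc c d, ((b : ℂ) + y * I) ∈ Icc a b ×ℂ Icc c d := fun y hy ↦
      ⟨by simpa using hab.le, by simpa using hy⟩
    have hbot_not : ∀ x ∈ Icc a b, ((x : ℂ) + c * I) ∉ Ioo a b ×ℂ Ioo c d := fun x _ h ↦ by
      have := h.2.1; simp at this
    have htop_not : ∀ x ∈ Icc a b, ((x : ℂ) + d * I) ∉ Ioo a b ×ℂ Ioo c d := fun x _ h ↦ by
      have := h.2.2; simp at this
    have hleft_not : ∀ y ∈ Icc c d, ((a : ℂ) + y * I) ∉ Ioo a b ×ℂ Ioo c d := fun y _ h ↦ by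
      have := h.1.1; simp at this
    have hright_not : ∀ y ∈ Icc c d, ((b : ℂ) + y * I) ∉ Ioo a b ×ℂ Ioo c d := fun y _ h ↦ by
      have := h.1.2; simp at this
    have hne_of_not : ∀ z, z ∉ Ioo a b ×ℂ Ioo c d → z ≠ ρ := fun z hz h ↦ hz (h ▸ hρS)
    -- continuity of the two summands at boundary points
    have hcont_inv : ∀ z ∈ Icc a b ×ℂ Icc c d, z ≠ ρ →
        ContinuousAt (fun w : ℂ ↦ (m : ℂ) * (g w / (w - ρ))) z := by
      intro z hz hzρ
      have h1 : ContinuousAt (fun w : ℂ ↦ w - ρ) z := continuousAt_id.sub continuousAt_const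
      exact (((hg z hz).continuousAt).div h1 (sub_ne_zero.2 hzρ)).const_mul _
    have hcont_f₁ : ∀ z ∈ Icc a b ×ℂ Icc c d, z ≠ ρ → f z ≠ 0 →
        ContinuousAt (fun w ↦ deriv f₁ w / f₁ w * g w) z := by
      intro z hz hzρ hfz
      have hf₁z : f₁ z ≠ 0 := by
        intro h0; exact hfz (by rw [hf_eq z hzρ, h0, mul_zero])
      exact (((hf₁_an z hz).deriv.continuousAt).div (hf₁_an z hz).continuousAt hf₁z).mul
        (hg z hz).continuousAt
    -- rewrite the boundary integral
    have step1 : rectBoundaryIntegral (fun z ↦ deriv f z / f z * g z) a b c d =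
        rectBoundaryIntegral (fun z ↦ (m : ℂ) * (g z / (z - ρ)) + deriv f₁ z / f₁ z * g z)
          a b c d := by
      refine rectBoundaryIntegral_congr hab.le hcd.le ?_ ?_ ?_ ?_
      · exact fun x hx ↦ hsplit _ (hbot_mem x hx) (hne_of_not _ (hbot_not x hx))
          (hbd _ (hbot_mem x hx) (hbot_not x hx))
      · exact fun x hx ↦ hsplit _ (htop_mem x hx) (hne_of_not _ (htop_not x hx))
          (hbd _ (htop_mem x hx) (htop_not x hx))
      · exact fun y hy ↦ hsplit _ (hleft_mem y hy) (hne_of_not _ (hleft_not y hy))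
          (hbd _ (hleft_mem y hy) (hleft_not y hy))
      · exact fun y hy ↦ hsplit _ (hright_mem y hy) (hne_of_not _ (hright_not y hy))
          (hbd _ (hright_mem y hy) (hright_not y hy))
    have step2 : rectBoundaryIntegral
        (fun z ↦ (m : ℂ) * (g z / (z - ρ)) + deriv f₁ z / f₁ z * g z) a b c d =
        rectBoundaryIntegral (fun z ↦ (m : ℂ) * (g z / (z - ρ))) a b c d +
          rectBoundaryIntegral (fun z ↦ deriv f₁ z / f₁ z * g z) a b c d := by
      refine rectBoundaryIntegral_add hab.le hcd.le ?_ ?_ ?_ ?_ ?_ ?_ ?_ ?_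
      · exact fun x hx ↦ hcont_inv _ (hbot_mem x hx) (hne_of_not _ (hbot_not x hx))
      · exact fun x hx ↦ hcont_inv _ (htop_mem x hx) (hne_of_not _ (htop_not x hx))
      · exact fun y hy ↦ hcont_inv _ (hleft_mem y hy) (hne_of_not _ (hleft_not y hy))
      · exact fun y hy ↦ hcont_inv _ (hright_mem y hy) (hne_of_not _ (hright_not y hy))
      · exact fun x hx ↦ hcont_f₁ _ (hbot_mem x hx) (hne_of_not _ (hbot_not x hx))
          (hbd _ (hbot_mem x hx) (hbot_not x hx))
      · exact fun x hx ↦ hcont_f₁ _ (htop_mem x hx) (hne_of_not _ (htop_not x hx))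
          (hbd _ (htop_mem x hx) (htop_not x hx))
      · exact fun y hy ↦ hcont_f₁ _ (hleft_mem y hy) (hne_of_not _ (hleft_not y hy))
          (hbd _ (hleft_mem y hy) (hleft_not y hy))
      · exact fun y hy ↦ hcont_f₁ _ (hright_mem y hy) (hne_of_not _ (hright_not y hy))
          (hbd _ (hright_mem y hy) (hright_not y hy))
    have step3 : rectBoundaryIntegral (fun z ↦ (m : ℂ) * (g z / (z - ρ))) a b c d =
        2 * Real.pi * I * m * g ρ :=
      rectBoundaryIntegral_const_mul_div_sub (m : ℂ) ρ hρS.1.1 hρS.1.2 hρS.2.1 hρS.2.2 hgd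
    -- orders: at ρ the order of f is m; elsewhere on S' the orders of f and f₁ agree
    have horder_ρ : ((meromorphicOrderAt f ρ).untop₀ : ℂ) = m := by
      rw [(hf ρ hρK).meromorphicOrderAt_eq, ← Nat.cast_analyticOrderNatAt hne_top]
      simp [hm]
    have horder_S' : ∀ ρ' ∈ S', ((meromorphicOrderAt f ρ').untop₀ : ℂ) * g ρ' =
        ((meromorphicOrderAt f₁ ρ').untop₀ : ℂ) * g ρ' := by
      intro ρ' hρ'
      have hne : ρ' ≠ ρ := fun h ↦ hρS' (h ▸ hρ')
      have hρ'K : ρ' ∈ Icc a b ×ℂ Icc c d := by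
        have := hsub' (Finset.mem_coe.2 hρ')
        exact ⟨Ioo_subset_Icc_self this.1, Ioo_subset_Icc_self this.2⟩
      have h1 : meromorphicOrderAt f ρ' = meromorphicOrderAt (fun w ↦ (w - ρ) ^ m * f₁ w) ρ' :=
        meromorphicOrderAt_congr ((hf_ev ρ' hne).filter_mono nhdsWithin_le_nhds)
      have hpow_an : AnalyticAt ℂ (fun w : ℂ ↦ (w - ρ) ^ m) ρ' :=
        (analyticAt_id.sub analyticAt_const).pow m
      have h2 : meromorphicOrderAt (fun w ↦ (w - ρ) ^ m * f₁ w) ρ' =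
          meromorphicOrderAt (fun w : ℂ ↦ (w - ρ) ^ m) ρ' + meromorphicOrderAt f₁ ρ' :=
        fun_meromorphicOrderAt_mul hpow_an.meromorphicAt (hf₁_an ρ' hρ'K).meromorphicAt
      have h3 : meromorphicOrderAt (fun w : ℂ ↦ (w - ρ) ^ m) ρ' = 0 := by
        rw [hpow_an.meromorphicOrderAt_eq,
          (hpow_an.analyticOrderAt_eq_zero.2 (pow_ne_zero _ (sub_ne_zero.2 hne)))]
        simp
      rw [h1, h2, h3, zero_add]
    -- assemble
    rw [step1, step2, step3, hIH, Finset.sum_insert hρS', horder_ρ,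
      Finset.sum_congr rfl horder_S']
    ring

/-- **The weighted argument principle on a rectangle.** Let `f`, `g` be analytic at every point of
the closed rectangle `R = [a,b] × [c,d]` (`a < b`, `c < d`), `f` non-zero on the four edges. Then,
in the four-term boundary convention (bottom − top + i·right − i·left),
`∮_{∂R} f'(z)/f(z) · g(z) dz = 2πi · Σ_{ρ ∈ R°, f(ρ) = 0} m(ρ) g(ρ)`, `m(ρ) = meromorphicOrderAt f ρ`
the multiplicity of the zero `ρ` (finite sum, `finite_zeros_reProdIm`).
[cite: Conway1978, Ch. V Thm. 3.6] -/
theorem integral_boundary_rect_logDeriv_mul {f g : ℂ → ℂ} (hab : a < b) (hcd : c < d)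
    (hf : AnalyticOnNhd ℂ f (Icc a b ×ℂ Icc c d)) (hg : AnalyticOnNhd ℂ g (Icc a b ×ℂ Icc c d))
    (h_bot : ∀ x ∈ Icc a b, f (x + c * I) ≠ 0) (h_top : ∀ x ∈ Icc a b, f (x + d * I) ≠ 0)
    (h_left : ∀ y ∈ Icc c d, f (a + y * I) ≠ 0) (h_right : ∀ y ∈ Icc c d, f (b + y * I) ≠ 0) :
    (∫ x : ℝ in a..b, deriv f (x + c * I) / f (x + c * I) * g (x + c * I)) -
      (∫ x : ℝ in a..b, deriv f (x + d * I) / f (x + d * I) * g (x + d * I)) +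
      I * (∫ y : ℝ in c..d, deriv f (b + y * I) / f (b + y * I) * g (b + y * I)) -
      I * (∫ y : ℝ in c..d, deriv f (a + y * I) / f (a + y * I) * g (a + y * I)) =
      2 * Real.pi * I * ∑ᶠ ρ ∈ {ρ : ℂ | f ρ = 0 ∧ ρ ∈ Ioo a b ×ℂ Ioo c d},
        ((meromorphicOrderAt f ρ).untop₀ : ℂ) * g ρ := by
  have hcorner : ((a : ℂ) + c * I) ∈ Icc a b ×ℂ Icc c d :=
    ⟨by simpa using hab.le, by simpa using hcd.le⟩
  have hw : f (a + c * I) ≠ 0 := h_bot a ⟨le_rfl, hab.le⟩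
  have hfin := finite_zeros_reProdIm hab.le hcd.le hf hcorner hw
  -- every zero in the closed rectangle is in the open rectangle
  have hzero : ∀ z ∈ Icc a b ×ℂ Icc c d, f z = 0 → z ∈ hfin.toFinset := by
    intro z hz h0
    rw [Set.Finite.mem_toFinset]
    refine ⟨h0, ?_⟩
    obtain ⟨⟨hza, hzb⟩, ⟨hzc, hzd⟩⟩ := hz
    have hz_eq : z = (z.re : ℂ) + (z.im : ℂ) * I := (re_add_im z).symm
    rcases hza.eq_or_lt with h | hza'
    · exact absurd h0 (by rw [hz_eq, ← h]; exact h_left z.im ⟨hzc, hzd⟩)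
    rcases hzb.eq_or_lt with h | hzb'
    · exact absurd h0 (by rw [hz_eq, h]; exact h_right z.im ⟨hzc, hzd⟩)
    rcases hzc.eq_or_lt with h | hzc'
    · exact absurd h0 (by rw [hz_eq, ← h]; exact h_bot z.re ⟨hza, hzb⟩)
    rcases hzd.eq_or_lt with h | hzd'
    · exact absurd h0 (by rw [hz_eq, h]; exact h_top z.re ⟨hza, hzb⟩)
    exact ⟨⟨hza', hzb'⟩, ⟨hzc', hzd'⟩⟩
  have hsub : ((hfin.toFinset : Set ℂ)) ⊆ Ioo a b ×ℂ Ioo c d := by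
    intro z hz
    rw [Set.Finite.coe_toFinset] at hz
    exact hz.2
  have := rectBoundaryIntegral_logDeriv_mul_eq_sum hab hcd hg hfin.toFinset f hf hzero hsub
  rw [rectBoundaryIntegral] at this
  rw [this, finsum_mem_eq_finite_toFinset_sum _ hfin]

end Literature.Analysis.Complex

end
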